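/-
Copyright (c) 2026 the pub-hodgecm-mathlib formalisation cell (harness21).  Prover seat hodgecm-mathlib-K2E3-p05 (g0), Track B «K2-LIT»,
engine E3 «EllipticInputs», unit U4 «Keys», 2026-09-03.  KERNEL module: THEOREMS ONLY (no definition, no named fact, no `sorry`,
no instance, no notation).
-/
import Summits.HodgeConjecture.HodgeConjecture.Theorems.K2E3PrincipalSeriesWeylReducible      -- ★ p855078 (this seat) part 1: `cmPrincipalSeries_weylConj_reducible_of_reducible`
import Summits.HodgeConjecture.HodgeConjecture.Theorems.K2E3NonUnitaryCharacterDichotomy      -- ★ p855108 (this seat) part 2: dichotomy, non-unitary ⇒ regular, flip lemmas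
import Summits.HodgeConjecture.HodgeConjecture.Theorems.F0P3cStCharTSUniqPar                   -- ★ `conjInvChar_normSqInv`, `conjInvChar_quadChar_mul_half` (the list is a `W`-orbit)
import HarnessLib

/-!
# K2 ∕ E3 «EllipticInputs», unit U4 «Keys» — «WE MAY ASSUME `Re s > 0`», assembled: [Keys1984 §7 Theorem (2)] in the organ's four-point form
# (hypothesis `hK` of ★ `K2E3CompZeroKeysListRegularOfKeysThmTwo`) FROM its printed two-point normal form «`Re s > 0`: `s = 1` or `s = ½`»

Cell hodgecm-mathlib (D-0151), FLOOR 0, Track B «K2-LIT», engine E3, crux item H413 = stmt-HodgeConjecture-24833 (route `HCCMUnconditional`, no route verbs);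
SIGS-TABLE-K2E3 row #5 (U4-b).  Author K2E3-p05 (g0).  `--supports stmt-HodgeConjecture-24833 --as helper`; THEOREMS ONLY.

THE MATHEMATICS.  Keys states Theorem (2) for `λ_s = λ|·|_E^s`, `λ` unitary, `Re s > 0` («We may assume Re λ > 0»): the reducible ones are `s = 1` (`λ = 1`) and
`s = ½` (`λ|_{F^×} = ω_{E/F}`-type) — in the organ's currency: a reducible `i_G(χ₁, χ₂)` with `χ₁` non-unitary and CONTRACTING (`‖x‖ < 1 ⇒ |χ₁ x| < 1`) has
`χ₁ = ‖·‖` (★ `halfModulusChar²`) or `χ₁ = η‖·‖^{1/2}` with `η|_{F^×} = ω` (★ `IsQuadraticCharExtension`).  This file derives the organ's symmetric four-point statement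
(`χ₁ ∈ {‖·‖^{±1}} ∪ {η‖·‖^{±1/2}}`, the hypothesis `hK` of ★ p854986 ∕ ★ p855006) from that normal form `hKpos`: by ★ part 2 a non-unitary `χ₁` is contracting or
expanding; contracting ⇒ `hKpos` directly; expanding ⇒ `χ` is regular (★ `cmTorusCharPair_ne_weyl_of_exists_norm_ne_one`), so `i_G(wχ)` is reducible too (★ part 1),
`wχ₁ = χ̄₁⁻¹` is non-unitary and contracting (★ flip lemmas), `hKpos` gives `χ̄₁⁻¹ ∈ {‖·‖, η‖·‖^{1/2}}`, and `w² = 1` with ★ `conjInvChar_normSqInv` ∕ ★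
`conjInvChar_quadChar_mul_half` (`w(η‖·‖^{1/2}) = η‖·‖^{-1/2}` for `η|_{F^×} = ω`) returns `χ₁ ∈ {‖·‖⁻¹, η‖·‖^{-1/2}}` with the SAME `η`.
So the residue of row #5 is now literally Keys' printed Theorem (2) in its `Re s > 0` normal form: **socket #5 ⟸ ★ p854986 ∘ this file ∘ `hKpos`**.
* §1 `keysThmTwo_of_contracting (hKpos) : ‹hK›` (the bytes of p854986's hypothesis).
HONEST LABEL: HC_CM is proved only modulo the 7 printed citations (2 remaining named inputs: hLiu418 = stmt-HodgeConjecture-24832, h413 = stmt-HodgeConjecture-24833)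
until rung 0 closes; this file discharges no printed citation — [Keys1984 §7 Thm (2)] (`Re s > 0` form) remains a hypothesis, never an axiom.

## References
* [Keys1984] D. Keys, *Principal series representations of special unitary groups over local fields*, Compositio Math. 51 (1984): §7 Theorem (2) p. 126 («Suppose
  `λ ∈ (E^×)^` and `Re s > 0`. The reducible non-unitary principal series `Ind_P^G λ_s` are the following: (a)–(d)»; «We may assume Re λ > 0»).
* [Rogawski1990] J. D. Rogawski, Ann. of Math. Stud. 123 (1990), §12.2 (1)–(2) p. 173; §12.1 p. 171.
* [BernsteinZelevinsky1977] I. N. Bernstein, A. V. Zelevinsky, Ann. Sci. ÉNS 10 (1977), Thm. 2.9.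
-/

set_option autoImplicit false
-- the mandated namespace has the single-problem summit's repeated segment (`HodgeConjecture.HodgeConjecture`)
set_option linter.dupNamespace false

noncomputable section

open NumberField IsDedekindDomain MeasureTheory
open scoped Matrix MatrixGroups NNReal
open Literature.NumberTheory.Automorphic Literature.NumberTheory.Automorphic.UnitaryGroup

namespace Summit.HodgeConjecture.HodgeConjecture.Cruxes.H413.K2E3KeysThmTwoOfContracting

set_option synthInstance.maxHeartbeats 400000 in
set_option maxHeartbeats 1600000 in
-- statement-heavy: the `SmoothInd` carrier of `cmPrincipalSeries` (same budget as the socket module)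
/-- **[Keys1984 §7 Thm (2)], four-point organ form, FROM its `Re s > 0` normal form.**  `hKpos`: at every non-split `v`, for continuous `χ₁, χ₂` with `χ₁` non-unitary
and CONTRACTING (`‖x‖ < 1 ⇒ |χ₁ x| < 1`, ★ `unitModulusChar`), a reducible `i_G(χ₁, χ₂)` has `χ₁ = ‖·‖` or `χ₁ = η‖·‖^{1/2}` with `η|_{F^×} = ω_{E/F}`, `η` continuous.
Conclusion: the hypothesis `hK` of ★ `compZeroKeysListRegular_of_keysThmTwo` ∕ ★ `keysReducibleList_of_keysThmTwo_of_irregularCaseThree` — a reducible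
`i_G(χ₁, χ₂)` with `χ₁` non-unitary has `χ₁ ∈ {‖·‖^{±1}} ∪ {η‖·‖^{±1/2}}`.  Proof: ★ dichotomy; the expanding case is moved to the contracting one by the Weyl flip
(★ non-unitary ⇒ regular, ★ `cmPrincipalSeries_weylConj_reducible_of_reducible`, ★ flip lemmas) and brought back by `w² = 1` (★ `conjInvChar_normSqInv`,
★ `conjInvChar_quadChar_mul_half`). [cite: Keys1984, §7 Theorem (2) p. 126] [cite: Rogawski1990, §12.2 (1)–(2) p. 173] [cite: BernsteinZelevinsky1977, Thm. 2.9] -/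
theorem keysThmTwo_of_contracting
    (hKpos : ∀ (L : Type) [Field L] [NumberField L] [IsCMField L] (v : HeightOneSpectrum (𝓞 ↥(maximalRealSubfield L))),
      (∀ w : PlacesOver L v, IsCMField.complexConj L • w.1 = w.1) →
      ∀ (χ₁ : (UnitaryGroup.LocalRing L v)ˣ →* ℂˣ) (χ₂ : ↥(normOneUnits (conjLocal L (IsCMField.complexConj L) v)) →* ℂˣ),
        Continuous (fun x => ((χ₁ x : ℂˣ) : ℂ)) → Continuous (fun x => ((χ₂ x : ℂˣ) : ℂ)) → (∃ x, ‖((χ₁ x : ℂˣ) : ℂ)‖ ≠ 1) →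
        (∀ x : (UnitaryGroup.LocalRing L v)ˣ, unitModulusChar (UnitaryGroup.LocalRing L v) x < 1 → ‖((χ₁ x : ℂˣ) : ℂ)‖ < 1) →
        (∃ N : Subrepresentation (UnitaryGroup.cmPrincipalSeries L 3 v (UnitaryGroup.cmTorusCharPair L v χ₁ χ₂)), N ≠ ⊥ ∧ N ≠ ⊤) →
        χ₁ = halfModulusChar (UnitaryGroup.LocalRing L v) * halfModulusChar (UnitaryGroup.LocalRing L v) ∨
        (∃ η : (UnitaryGroup.LocalRing L v)ˣ →* ℂˣ, IsQuadraticCharExtension (conjLocal L (IsCMField.complexConj L) v) η ∧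
          Continuous (fun x => ((η x : ℂˣ) : ℂ)) ∧ χ₁ = η * halfModulusChar (UnitaryGroup.LocalRing L v))) :
    ∀ (L : Type) [Field L] [NumberField L] [IsCMField L] (v : HeightOneSpectrum (𝓞 ↥(maximalRealSubfield L))),
      (∀ w : PlacesOver L v, IsCMField.complexConj L • w.1 = w.1) →
      ∀ (χ₁ : (UnitaryGroup.LocalRing L v)ˣ →* ℂˣ) (χ₂ : ↥(normOneUnits (conjLocal L (IsCMField.complexConj L) v)) →* ℂˣ),
        Continuous (fun x => ((χ₁ x : ℂˣ) : ℂ)) → Continuous (fun x => ((χ₂ x : ℂˣ) : ℂ)) → (∃ x, ‖((χ₁ x : ℂˣ) : ℂ)‖ ≠ 1) →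
        (∃ N : Subrepresentation (UnitaryGroup.cmPrincipalSeries L 3 v (UnitaryGroup.cmTorusCharPair L v χ₁ χ₂)), N ≠ ⊥ ∧ N ≠ ⊤) →
        (χ₁ = halfModulusChar (UnitaryGroup.LocalRing L v) * halfModulusChar (UnitaryGroup.LocalRing L v) ∨
          χ₁ = (halfModulusChar (UnitaryGroup.LocalRing L v) * halfModulusChar (UnitaryGroup.LocalRing L v))⁻¹) ∨
        (∃ η : (UnitaryGroup.LocalRing L v)ˣ →* ℂˣ, IsQuadraticCharExtension (conjLocal L (IsCMField.complexConj L) v) η ∧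
          Continuous (fun x => ((η x : ℂˣ) : ℂ)) ∧
          (χ₁ = η * halfModulusChar (UnitaryGroup.LocalRing L v) ∨ χ₁ = η * (halfModulusChar (UnitaryGroup.LocalRing L v))⁻¹)) := by
  intro L _ _ _ v hns χ₁ χ₂ h₁ h₂ hnu hred
  rcases K2E3NonUnitaryCharacterDichotomy.contracting_or_expanding_of_exists_norm_ne_one L v hns χ₁ h₁ hnu with hc | he
  · rcases hKpos L v hns χ₁ χ₂ h₁ h₂ hnu hc hred with h | ⟨η, hq, hηc, h⟩
    · exact Or.inl (Or.inl h)
    · exact Or.inr ⟨η, hq, hηc, Or.inl h⟩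
  · -- the expanding case: flip by `w`
    have h₁' : Continuous fun x => ((UnitaryGroup.conjInvChar (conjLocal L (IsCMField.complexConj L) v) χ₁ x : ℂˣ) : ℂ) :=
      F0P2pTorusPairsAndVacuity.continuous_coe_conjInvChar _ (continuous_conjLocal L (IsCMField.complexConj L) v) χ₁ h₁
    have hnu' := K2E3NonUnitaryCharacterDichotomy.exists_norm_conjInvChar_ne_one L v χ₁ hnu
    have hc' : ∀ x : (UnitaryGroup.LocalRing L v)ˣ, unitModulusChar (UnitaryGroup.LocalRing L v) x < 1 →
        ‖((UnitaryGroup.conjInvChar (conjLocal L (IsCMField.complexConj L) v) χ₁ x : ℂˣ) : ℂ)‖ < 1 :=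
      fun x hx => K2E3NonUnitaryCharacterDichotomy.conjInvChar_contracting_of_expanding L v χ₁ he x hx
    have hreg := K2E3NonUnitaryCharacterDichotomy.cmTorusCharPair_ne_weyl_of_exists_norm_ne_one L v hns χ₁ χ₂ h₁ hnu
    have hred' := K2E3PrincipalSeriesWeylReducible.cmPrincipalSeries_weylConj_reducible_of_reducible L v hns χ₁ χ₂ h₁ h₂ hreg hred
    have hww : UnitaryGroup.conjInvChar (conjLocal L (IsCMField.complexConj L) v)
        (UnitaryGroup.conjInvChar (conjLocal L (IsCMField.complexConj L) v) χ₁) = χ₁ :=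
      F0P2pTorusPairsAndVacuity.conjInvChar_conjInvChar _ (conjLocal_conjLocal_cm L v) χ₁
    have hsq : UnitaryGroup.conjInvChar (conjLocal L (IsCMField.complexConj L) v)
        (halfModulusChar (UnitaryGroup.LocalRing L v) * halfModulusChar (UnitaryGroup.LocalRing L v)) =
          (halfModulusChar (UnitaryGroup.LocalRing L v) * halfModulusChar (UnitaryGroup.LocalRing L v))⁻¹ := by
      have e := congrArg (UnitaryGroup.conjInvChar (conjLocal L (IsCMField.complexConj L) v)) (F0P3cStCharTSUniqPar.conjInvChar_normSqInv L v)
      rw [F0P2pTorusPairsAndVacuity.conjInvChar_conjInvChar _ (conjLocal_conjLocal_cm L v)] at e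
      exact e.symm
    rcases hKpos L v hns (UnitaryGroup.conjInvChar (conjLocal L (IsCMField.complexConj L) v) χ₁) χ₂ h₁' h₂ hnu' hc' hred' with h | ⟨η, hq, hηc, h⟩
    · refine Or.inl (Or.inr ?_)
      rw [← hww, h, hsq]
    · refine Or.inr ⟨η, hq, hηc, Or.inr ?_⟩
      rw [← hww, h, F0P3cStCharTSUniqPar.conjInvChar_quadChar_mul_half L v η hq]

end Summit.HodgeConjecture.HodgeConjecture.Cruxes.H413.K2E3KeysThmTwoOfContracting

end
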